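import Mathlib
import Summits.Ventures.FusionMHD.Models.SAlphaSecondStableS1A28Point
import Summits.Ventures.FusionMHD.Models.SAlphaSecondStableS125A325Point
import Summits.Ventures.FusionMHD.Models.SAlphaSecondStableS15A3575Point
import Summits.Ventures.FusionMHD.Models.SAlphaSecondStableS2A425Point
import Summits.Ventures.FusionMHD.Models.SAlphaSecondStableS25A5075Point
import Summits.Ventures.FusionMHD.Models.SAlphaSecondStableS3A5675Point
import Summits.Ventures.FusionMHD.Bench.BallooningSAlphaSecondEdgeBands
import HarnessLib

/-!
# F3 — THE SECOND STABILITY EDGE OF THE `s–α` MODEL, TWO-SIDED, AT 6 SHEARS: one table of CLOSED brackets `[lo_s, hi_s]`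
# (unstable end = gridfusion-lit-3's finite-element band ★ #285 BY NAME; stable end = gridfusion-model-7's multi-piece core certificates BY NAME)
(venture LADDER-GRIDFUSION, rung F3; cell `gridfusion`; gridfusion-model-7 (g10), 2026-08-28.  RECORD-ONLY under DIRECTOR RULING 73 (1) (★ census frozen by RULING 70; this
file is tree hygiene — not a ★ row, no word, not rung movement).  DIRECTOR class reading I4107 (2): the second stability edge
is «a second bracketed quantity per shear», carried beside — never merged into — the eight-point first-stability curve; ★ #284 booked the `s = 3`
bracket, ★ #285 the one-sided unstable bands at eight shears as ONE table row.  THIS file is the two-sided table: no new kernel computation, only the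
conjunction of cells already in the tree (every conjunct BY NAME).  0 `decide`, 0 kit, no `native_decide`.)

THE TABLE (each row: `¬ StableSide s lo ∧ StableSide s hi`, i.e. `lo ∈ U_s` and `hi ∉ U_s`, so `sup {α ≤ hi : α ∈ U_s} ∈ [lo, hi]` CLOSED):
* `s = 1`: second edge `∈ [129/50, 14/5]` (width `11/50`) — unstable end = lit-3's ★ #285 band (`unstable_from_lensLo_one`, `U_s ⊇ [31/50, 129/50]`), stable end = `SAlphaSecondStableS1A28Point.stableSide_one_28` (gridfusion-model-7 g10);
* `s = 5/4`: second edge `∈ [3, 13/4]` (width `1/4`) — unstable end = lit-3's ★ #285 band (`unstable_from_lensLo_fiveQuarters`, `U_s ⊇ [331/400, 3]`), stable end = `SAlphaSecondStableS125A325Point.stableSide_fiveQuarters_325` (gridfusion-model-7 g10);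
* `s = 3/2`: second edge `∈ [17/5, 143/40]` (width `7/40`) — unstable end = lit-3's ★ #285 band (`unstable_from_lensLo_threeHalves`, `U_s ⊇ [39/40, 17/5]`), stable end = `SAlphaSecondStableS15A3575Point.stableSide_threeHalves_3575` (gridfusion-model-7 g9/g10);
* `s = 2`: second edge `∈ [417/100, 17/4]` (width `2/25`) — unstable end = lit-3's ★ #285 band (`unstable_from_lensLo_two`, `U_s ⊇ [27/20, 417/100]`), stable end = `SAlphaSecondStableS2A425Point.stableSide_two_425` (gridfusion-model-7 g10);
* `s = 5/2`: second edge `∈ [49/10, 203/40]` (width `7/40`) — unstable end = lit-3's ★ #285 band (`unstable_from_lensLo_fiveHalves`, `U_s ⊇ [7/4, 49/10]`), stable end = `SAlphaSecondStableS25A5075Point.stableSide_fiveHalves_5075` (gridfusion-model-7 g10);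
* `s = 3`: second edge `∈ [28/5, 227/40]` (width `3/40`) — unstable end = lit-3's ★ #285 band (`unstable_from_lensLo_three`, `U_s ⊇ [11/5, 28/5]`), stable end = `SAlphaSecondStableS3A5675Point.stableSide_three_5675` (gridfusion-model-7 g10);

## THREE COLUMNS
CERTIFIED: in the `s–α` ballooning MODEL (Freidberg (12.96)–(12.99), `θ₀ = 0`), at each listed shear the two named tree theorems give a point of the
unstable set `U_s` (a compact window with a `C¹` trial function of negative one-surface energy) and a LARGER `α` on the stable side (no window carries a
witness) — hence the CLOSED bracket for the second stability edge at that shear; nothing between the listed shears; monotonicity / connectedness of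
`U_s` in `α` NOT typed (the brackets are set-theoretic statements).  VALIDATED (not in the kernel): float E–L shooting second edges (lit-3 `edges.py`)
`5.614 (s = 3)`, `4.907 (5/2)`, `4.178 (2)`, `3.417 (3/2)`, `3.019 (5/4)`, `≈ 2.6 (1)`; Freidberg Fig. 12.5 (second stable region, qualitative).
MODELLED: `s–α` model (large-aspect-ratio shifted circles, high-`n` ballooning ordering, `θ₀ = 0`, ideal MHD); the second-stability ACCESS question of
a device involves all `θ₀` and the equilibrium path — NOTHING here is about a device or a `β`-limit.  Citations: Freidberg 2014 §12.3 (12.38)–(12.40),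
§12.6.2 (12.96)–(12.100), Fig. 12.5 [Freidberg2014].
-/

open Literature.MathematicalPhysics.MHD.Ballooning Literature.MathematicalPhysics.MHD.Ballooning.SAlpha
open Set

namespace Summit.Ventures.FusionMHD.Bench.SAlphaSecondEdgeBrackets

/-- `s = 1`: the SECOND stability edge of the MODEL lies in `[129/50, 14/5]` — `(1, 129/50)` carries an instability witness
(gridfusion-lit-3's band, ★ #285) and `(1, 14/5)` is on the stable side (gridfusion-model-7 g10). [cite: Freidberg2014, §12.3 eqs. (12.38)–(12.40)] -/
theorem secondEdge_bracket_one : ¬ StableSide (1) (129/50) ∧ StableSide (1) (14/5) := by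
  refine ⟨?_, Summit.Ventures.FusionMHD.Models.SAlphaSecondStableS1A28.stableSide_one_28⟩
  obtain ⟨a, b, X, X', hw⟩ := SAlphaSecondEdgeBands.unstable_from_lensLo_one (α := 129/50) (by norm_num) (by norm_num)
  exact fun hs => hs a b X X' hw

/-- `s = 5/4`: the SECOND stability edge of the MODEL lies in `[3, 13/4]` — `(5/4, 3)` carries an instability witness
(gridfusion-lit-3's band, ★ #285) and `(5/4, 13/4)` is on the stable side (gridfusion-model-7 g10). [cite: Freidberg2014, §12.3 eqs. (12.38)–(12.40)] -/
theorem secondEdge_bracket_fiveQuarters : ¬ StableSide (5/4) (3) ∧ StableSide (5/4) (13/4) := by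
  refine ⟨?_, Summit.Ventures.FusionMHD.Models.SAlphaSecondStableS125A325.stableSide_fiveQuarters_325⟩
  obtain ⟨a, b, X, X', hw⟩ := SAlphaSecondEdgeBands.unstable_from_lensLo_fiveQuarters (α := 3) (by norm_num) (by norm_num)
  exact fun hs => hs a b X X' hw

/-- `s = 3/2`: the SECOND stability edge of the MODEL lies in `[17/5, 143/40]` — `(3/2, 17/5)` carries an instability witness
(gridfusion-lit-3's band, ★ #285) and `(3/2, 143/40)` is on the stable side (gridfusion-model-7 g9/g10). [cite: Freidberg2014, §12.3 eqs. (12.38)–(12.40)] -/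
theorem secondEdge_bracket_threeHalves : ¬ StableSide (3/2) (17/5) ∧ StableSide (3/2) (143/40) := by
  refine ⟨?_, Summit.Ventures.FusionMHD.Models.SAlphaSecondStableS15A3575.stableSide_threeHalves_3575⟩
  obtain ⟨a, b, X, X', hw⟩ := SAlphaSecondEdgeBands.unstable_from_lensLo_threeHalves (α := 17/5) (by norm_num) (by norm_num)
  exact fun hs => hs a b X X' hw

/-- `s = 2`: the SECOND stability edge of the MODEL lies in `[417/100, 17/4]` — `(2, 417/100)` carries an instability witness
(gridfusion-lit-3's band, ★ #285) and `(2, 17/4)` is on the stable side (gridfusion-model-7 g10). [cite: Freidberg2014, §12.3 eqs. (12.38)–(12.40)] -/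
theorem secondEdge_bracket_two : ¬ StableSide (2) (417/100) ∧ StableSide (2) (17/4) := by
  refine ⟨?_, Summit.Ventures.FusionMHD.Models.SAlphaSecondStableS2A425.stableSide_two_425⟩
  obtain ⟨a, b, X, X', hw⟩ := SAlphaSecondEdgeBands.unstable_from_lensLo_two (α := 417/100) (by norm_num) (by norm_num)
  exact fun hs => hs a b X X' hw

/-- `s = 5/2`: the SECOND stability edge of the MODEL lies in `[49/10, 203/40]` — `(5/2, 49/10)` carries an instability witness
(gridfusion-lit-3's band, ★ #285) and `(5/2, 203/40)` is on the stable side (gridfusion-model-7 g10). [cite: Freidberg2014, §12.3 eqs. (12.38)–(12.40)] -/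
theorem secondEdge_bracket_fiveHalves : ¬ StableSide (5/2) (49/10) ∧ StableSide (5/2) (203/40) := by
  refine ⟨?_, Summit.Ventures.FusionMHD.Models.SAlphaSecondStableS25A5075.stableSide_fiveHalves_5075⟩
  obtain ⟨a, b, X, X', hw⟩ := SAlphaSecondEdgeBands.unstable_from_lensLo_fiveHalves (α := 49/10) (by norm_num) (by norm_num)
  exact fun hs => hs a b X X' hw

/-- `s = 3`: the SECOND stability edge of the MODEL lies in `[28/5, 227/40]` — `(3, 28/5)` carries an instability witness
(gridfusion-lit-3's band, ★ #285) and `(3, 227/40)` is on the stable side (gridfusion-model-7 g10). [cite: Freidberg2014, §12.3 eqs. (12.38)–(12.40)] -/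
theorem secondEdge_bracket_three : ¬ StableSide (3) (28/5) ∧ StableSide (3) (227/40) := by
  refine ⟨?_, Summit.Ventures.FusionMHD.Models.SAlphaSecondStableS3A5675.stableSide_three_5675⟩
  obtain ⟨a, b, X, X', hw⟩ := SAlphaSecondEdgeBands.unstable_from_lensLo_three (α := 28/5) (by norm_num) (by norm_num)
  exact fun hs => hs a b X X' hw

/-- ★★★ THE TWO-SIDED SECOND-EDGE TABLE of the `s–α` MODEL at 6 shears (every conjunct BY NAME from the tree).
[cite: Freidberg2014, §12.6.2 eqs. (12.97)–(12.100)] (second stable region, Fig. 12.5, for the MODEL) -/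
theorem secondEdge_brackets :
    (¬ StableSide (1) (129/50) ∧ StableSide (1) (14/5)) ∧
    (¬ StableSide (5/4) (3) ∧ StableSide (5/4) (13/4)) ∧
    (¬ StableSide (3/2) (17/5) ∧ StableSide (3/2) (143/40)) ∧
    (¬ StableSide (2) (417/100) ∧ StableSide (2) (17/4)) ∧
    (¬ StableSide (5/2) (49/10) ∧ StableSide (5/2) (203/40)) ∧
    (¬ StableSide (3) (28/5) ∧ StableSide (3) (227/40)) :=
  ⟨secondEdge_bracket_one, secondEdge_bracket_fiveQuarters, secondEdge_bracket_threeHalves, secondEdge_bracket_two, secondEdge_bracket_fiveHalves, secondEdge_bracket_three⟩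

end Summit.Ventures.FusionMHD.Bench.SAlphaSecondEdgeBrackets
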